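import Mathlib
import Summits.NavierStokesRegularity.NavierStokesRegularity.Theorems.TaoLadderRungTwoFlatHopRuleGlue
import HarnessLib

/-!
# The anchor-scale lower bound `a_lo ≤ clampedRatio` (input `halo` of `HopTube.tubeStepNearBehindR54_of_schedule_halo`) from a
  landing-carrier lower bound, and the carrier lower bound from the reference flow and the core deviation at the front shell
  (helper for the K_A♭ parent item stmt-NavierStokesRegularity-22987 `FlatGapCertificatesV2`, child 2A `GradedAdiabaticWakeA` of
  route TaoLadderRungTwoFlat; cell harvest/h2-tao-ladder, p1 g23; LADDER §50 (clamped anchor), §59 (TRAP #18), §60)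

`clampedRatio P i₀ ε₀ θ₀ t S = max((1+ε₀)^{−θ₀}, |S_{i₀,1}(t)|/A_*)`, so any `a_lo` with `a_lo·A_* ≤ |S_{i₀,1}(t)|` is below it; and the
landing carrier is at least the reference carrier minus the core deviation at the front shell during the section window:
`|S_{i₀,1}(t)| ≥ |W_{i₀,1}(t)| − |(S−W)_{i₀,1}(t)|`. The two inputs (reference carrier lower bound over the window, core deviation at
shell `1`) are schedule / core-zone data.

* `le_clampedRatio_of_carrier` — `a_lo·A_* ≤ |S_{i₀,1}(t)| ⟹ a_lo ≤ clampedRatio`;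
* `carrier_lower_of_reference` — `|W_{i₀,1}(t)| ≥ c_W`, `|(S−W)_{i₀,1}(t)| ≤ d ⟹ |S_{i₀,1}(t)| ≥ c_W − d`;
* `le_clampedRatio_of_reference` — the composition: `a_lo·A_* + d ≤ c_W ⟹ a_lo ≤ clampedRatio`.

HONEST FRAMING: elementary bookkeeping over the cell's typed frame (MODEL lattice); the reference carrier and the core deviation are
HYPOTHESES; nothing certified; no item closed; nothing about the Navier–Stokes equations.
-/

noncomputable section

-- the sub-problem namespace repeats the summit name by design (D-0017)
set_option linter.dupNamespace false

namespace Summit.NavierStokesRegularity.NavierStokesRegularity.Theorems.HopTube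

open Set

/-- **`a_lo ≤ clampedRatio` from a carrier lower bound**: `0 < A_*`, `a_lo·A_* ≤ |S_{i₀,1}(t)|`.
[cite: Tao2016AveragedNS, §6.4 Prop. 6.5 (checkpoint ratio, statement shape); cell LADDER §50.7 (B), §59 (TRAP #18 cure, `halo`)] -/
theorem le_clampedRatio_of_carrier (P : TubeSchedule) (i₀ : Fin 2) (ε₀ θ₀ t : ℝ) (S : Fin 2 → ℤ → ℝ → ℝ) {alo : ℝ}
    (hA : 0 < P.Astar) (h : alo * P.Astar ≤ |S i₀ 1 t|) : alo ≤ clampedRatio P i₀ ε₀ θ₀ t S := by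
  have h1 : alo ≤ |S i₀ 1 t| / P.Astar := by rw [le_div_iff₀ hA]; exact h
  exact h1.trans (anchor_div_le_clampedRatio P i₀ ε₀ θ₀ t S)

/-- **Landing carrier from the reference**: `|W_{i₀,1}(t)| ≥ c_W` and `|(S−W)_{i₀,1}(t)| ≤ d` give `|S_{i₀,1}(t)| ≥ c_W − d`.
[cite: Tao2016AveragedNS, §6.3–6.4 (statement shape); cell LADDER §60 (core deviation at the front shell)] -/
theorem carrier_lower_of_reference {S W : Fin 2 → ℤ → ℝ → ℝ} {i₀ : Fin 2} {t cW d : ℝ}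
    (hW : cW ≤ |W i₀ 1 t|) (hd : |(S - W) i₀ 1 t| ≤ d) : cW - d ≤ |S i₀ 1 t| := by
  have h1 : |W i₀ 1 t| - |(S - W) i₀ 1 t| ≤ |S i₀ 1 t| := by
    have e : S i₀ 1 t = W i₀ 1 t + (S - W) i₀ 1 t := by simp only [Pi.sub_apply]; ring
    have := abs_sub_abs_le_abs_sub (W i₀ 1 t) (-((S - W) i₀ 1 t))
    rw [abs_neg, sub_neg_eq_add, ← e] at this
    linarith
  linarith

/-- **`a_lo ≤ clampedRatio` from the reference carrier and the core deviation at the front shell**: `a_lo·A_* + d ≤ c_W`.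
[cite: Tao2016AveragedNS, §6.4 Prop. 6.5 (statement shape); cell LADDER §59–§60 (`halo` input of the composed near/behind step)] -/
theorem le_clampedRatio_of_reference (P : TubeSchedule) (i₀ : Fin 2) (ε₀ θ₀ t : ℝ) {S W : Fin 2 → ℤ → ℝ → ℝ}
    {alo cW d : ℝ} (hA : 0 < P.Astar) (hW : cW ≤ |W i₀ 1 t|) (hd : |(S - W) i₀ 1 t| ≤ d)
    (h : alo * P.Astar + d ≤ cW) : alo ≤ clampedRatio P i₀ ε₀ θ₀ t S :=
  le_clampedRatio_of_carrier P i₀ ε₀ θ₀ t S hA (by linarith [carrier_lower_of_reference hW hd])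

end Summit.NavierStokesRegularity.NavierStokesRegularity.Theorems.HopTube

end
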